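import Mathlib.Algebra.Module.BigOperators
import Mathlib.Analysis.SpecificLimits.Basic
import Mathlib.Data.Finset.CastCard
import Summits.QuantumAdvantage.QuantumAdvantage.Theorems.AvgFaceBeyondPrior.Negative.AvgFaceBeyondPriorNecessary
import Literature.NumberTheory.QuadraticFields.ThreeTorsionMeanLocalAtThree
import Literature.NumberTheory.QuadraticFields.ThreeTorsion

/-!
# Stub `stub_mirrorRankRare` of line `mirror-unit-signature` (crux `AvgFaceBeyondPrior`)

For `d` in the dyadic block `𝒟ₙ = Negative.fundBlock n = {2^(n-1) ≤ d < 2ⁿ : −d fundamental}` let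
`D⁺(d) = disc ℚ(√3d)`, i.e. `d/3` if `3 ∣ d` and `3d` otherwise. GIVEN the two Bhargava–Varma
named facts of `ThreeTorsionMeanLocalAtThree.lean` (mean `4/3` of `#Cl₃` over real quadratic
fields with `3` ramified, resp. unramified; positive density of both families), for every `ε > 0`,
eventually `#{d ∈ 𝒟ₙ : #Cl₃(D⁺(d)) ≠ 1} ≤ (1/6 + ε) · #𝒟ₙ`. Proof: `d ↦ 3d` maps `{d ∈ 𝒟ₙ : 3 ∤ d}`
bijectively onto the positive fundamental `D` with `3·2^(n-1) ≤ D < 3·2ⁿ`, `3 ∣ D`, and `d ↦ d/3`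
maps `{d ∈ 𝒟ₙ : 3 ∣ d}` (`n ≥ 3`) onto those with `2^(n-1) ≤ 3D < 2ⁿ`, `3 ∤ D`
(`sum_fundBlock_mirror_eq`); window sums are differences of the facts' running sums;
`#Cl₃ ≠ 1 ⇒ #Cl₃ ≥ 3` gives `#{≠ 1} ≤ ½ Σ (#Cl₃ − 1)`; the main terms add up to exactly
`(1/6) #𝒟ₙ`, and `#𝒟ₙ ≍ 2ⁿ` absorbs the `o(2ⁿ)`.
-/

namespace Summit.QuantumAdvantage.QuantumAdvantage.Theorems.AvgFaceBeyondPrior.Mirror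

open Filter Topology Literature.NumberTheory.QuadraticFields
open Summit.QuantumAdvantage.QuantumAdvantage.Theorems.AvgFaceBeyondPrior

/-! ### Arithmetic of the mirror map `d ↦ D⁺(d)` -/

/-- `3m` is squarefree iff `m` is squarefree and prime to `3`. [folklore] -/
theorem squarefree_three_mul_iff {m : ℕ} : Squarefree (3 * m) ↔ Squarefree m ∧ ¬ 3 ∣ m := by
  rw [Nat.squarefree_mul_iff, Nat.Prime.coprime_iff_not_dvd Nat.prime_three]
  exact ⟨fun h => ⟨h.2.2, h.1⟩, fun h => ⟨h.2, Nat.prime_three.prime.squarefree, h.1⟩⟩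

/-- `ℕ`-form of the route's literal predicate "`−d` fundamental": `d ≡ 3 (mod 4)` squarefree, or
`d ≡ 4, 8 (mod 16)` with `d/4` squarefree. [folklore] -/
theorem negFund_iff_nat {d : ℕ} :
    (-(d:ℤ) % 4 = 1 ∧ Squarefree (-(d:ℤ)) ∧ -(d:ℤ) ≠ 1 ∨
        4 ∣ -(d:ℤ) ∧ (-(d:ℤ) / 4 % 4 = 2 ∨ -(d:ℤ) / 4 % 4 = 3) ∧ Squarefree (-(d:ℤ) / 4)) ↔
      (d % 4 = 3 ∧ Squarefree d) ∨ ((d % 16 = 4 ∨ d % 16 = 8) ∧ Squarefree (d / 4)) := by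
  have hsq1 : Squarefree (-(d:ℤ)) ↔ Squarefree d := by
    rw [← Int.squarefree_natAbs, Int.natAbs_neg, Int.natAbs_natCast]
  have hq : (-(d:ℤ)) / 4 = -(((d + 3) / 4 : ℕ) : ℤ) := by omega
  have hsq2 : Squarefree ((-(d:ℤ)) / 4) ↔ Squarefree ((d + 3) / 4) := by
    rw [hq, ← Int.squarefree_natAbs, Int.natAbs_neg, Int.natAbs_natCast]
  rw [hsq1, hsq2]
  constructor
  · rintro (⟨h1, h2, -⟩ | ⟨h4, h2, h3⟩)
    · exact Or.inl ⟨by omega, h2⟩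
    · refine Or.inr ⟨by omega, ?_⟩
      rwa [show (d + 3) / 4 = d / 4 by omega] at h3
  · rintro (⟨h1, h2⟩ | ⟨h1, h3⟩)
    · exact Or.inl ⟨by omega, h2, by omega⟩
    · refine Or.inr ⟨by omega, by omega, ?_⟩
      rwa [show (d + 3) / 4 = d / 4 by omega]

/-- `ℕ`-form of "`D` is a positive fundamental discriminant": `D ≡ 1 (mod 4)` squarefree `≠ 1`, or
`D ≡ 8, 12 (mod 16)` with `D/4` squarefree. [folklore] -/
theorem posFund_natCast_iff {D : ℕ} :
    ((D:ℤ) % 4 = 1 ∧ Squarefree (D:ℤ) ∧ (D:ℤ) ≠ 1 ∨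
        4 ∣ (D:ℤ) ∧ ((D:ℤ) / 4 % 4 = 2 ∨ (D:ℤ) / 4 % 4 = 3) ∧ Squarefree ((D:ℤ) / 4)) ↔
      (D % 4 = 1 ∧ Squarefree D ∧ D ≠ 1) ∨ ((D % 16 = 8 ∨ D % 16 = 12) ∧ Squarefree (D / 4)) := by
  have hq : (D:ℤ) / 4 = ((D / 4 : ℕ) : ℤ) := by omega
  rw [hq, Int.squarefree_natCast, Int.squarefree_natCast]
  constructor
  · rintro (⟨h1, h2, h3⟩ | ⟨h4, h2, h3⟩)
    · exact Or.inl ⟨by omega, h2, by omega⟩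
    · exact Or.inr ⟨by omega, h3⟩
  · rintro (⟨h1, h2, h3⟩ | ⟨h1, h3⟩)
    · exact Or.inl ⟨by omega, h2, by omega⟩
    · exact Or.inr ⟨by omega, by omega, h3⟩

/-- The ramified leg of the mirror map: `3d` is a positive fundamental discriminant iff `−d` is
fundamental and `3 ∤ d`. [folklore] -/
theorem posFund_three_mul_iff {d : ℕ} :
    (3 * (d:ℤ) % 4 = 1 ∧ Squarefree (3 * (d:ℤ)) ∧ 3 * (d:ℤ) ≠ 1 ∨
        4 ∣ 3 * (d:ℤ) ∧ (3 * (d:ℤ) / 4 % 4 = 2 ∨ 3 * (d:ℤ) / 4 % 4 = 3) ∧ Squarefree (3 * (d:ℤ) / 4)) ↔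
      (-(d:ℤ) % 4 = 1 ∧ Squarefree (-(d:ℤ)) ∧ -(d:ℤ) ≠ 1 ∨
          4 ∣ -(d:ℤ) ∧ (-(d:ℤ) / 4 % 4 = 2 ∨ -(d:ℤ) / 4 % 4 = 3) ∧ Squarefree (-(d:ℤ) / 4)) ∧
        ¬ 3 ∣ d := by
  have hc : (3 * (d:ℤ)) = ((3 * d : ℕ) : ℤ) := by push_cast; ring
  rw [hc, posFund_natCast_iff, negFund_iff_nat, squarefree_three_mul_iff]
  constructor
  · rintro (⟨h1, ⟨h2, h3⟩, -⟩ | ⟨h1, h2⟩)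
    · exact ⟨Or.inl ⟨by omega, h2⟩, h3⟩
    · rw [show 3 * d / 4 = 3 * (d / 4) by omega, squarefree_three_mul_iff] at h2
      exact ⟨Or.inr ⟨by omega, h2.1⟩, by omega⟩
  · rintro ⟨⟨h1, h2⟩ | ⟨h1, h2⟩, h3⟩
    · exact Or.inl ⟨by omega, ⟨h2, h3⟩, by omega⟩
    · refine Or.inr ⟨by omega, ?_⟩
      rw [show 3 * d / 4 = 3 * (d / 4) by omega, squarefree_three_mul_iff]
      exact ⟨h2, by omega⟩

/-- The unramified leg of the mirror map: for `D ≠ 1`, `−3D` is fundamental iff `D` is a positive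
fundamental discriminant with `3 ∤ D`. (`D = 1`: `−3` is fundamental, `1` is not.) [folklore] -/
theorem negFund_three_mul_iff {D : ℕ} (hD : D ≠ 1) :
    (-((3 * D : ℕ) : ℤ) % 4 = 1 ∧ Squarefree (-((3 * D : ℕ) : ℤ)) ∧ -((3 * D : ℕ) : ℤ) ≠ 1 ∨
        4 ∣ -((3 * D : ℕ) : ℤ) ∧ (-((3 * D : ℕ) : ℤ) / 4 % 4 = 2 ∨ -((3 * D : ℕ) : ℤ) / 4 % 4 = 3) ∧
          Squarefree (-((3 * D : ℕ) : ℤ) / 4)) ↔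
      ((D:ℤ) % 4 = 1 ∧ Squarefree (D:ℤ) ∧ (D:ℤ) ≠ 1 ∨
          4 ∣ (D:ℤ) ∧ ((D:ℤ) / 4 % 4 = 2 ∨ (D:ℤ) / 4 % 4 = 3) ∧ Squarefree ((D:ℤ) / 4)) ∧
        ¬ 3 ∣ D := by
  rw [negFund_iff_nat, posFund_natCast_iff, squarefree_three_mul_iff]
  constructor
  · rintro (⟨h1, h2, h3⟩ | ⟨h1, h2⟩)
    · exact ⟨Or.inl ⟨by omega, h2, hD⟩, h3⟩
    · rw [show 3 * D / 4 = 3 * (D / 4) by omega, squarefree_three_mul_iff] at h2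
      exact ⟨Or.inr ⟨by omega, h2.1⟩, by omega⟩
  · rintro ⟨⟨h1, h2, -⟩ | ⟨h1, h2⟩, h3⟩
    · exact Or.inl ⟨by omega, h2, h3⟩
    · refine Or.inr ⟨by omega, ?_⟩
      rw [show 3 * D / 4 = 3 * (D / 4) by omega, squarefree_three_mul_iff]
      exact ⟨h2, by omega⟩

/-- `posFundDiscrs` is monotone in the cut-off. [folklore] -/
theorem posFundDiscrs_mono {X Y : ℕ} (h : X ≤ Y) : posFundDiscrs X ⊆ posFundDiscrs Y := by
  intro D hD
  rw [mem_posFundDiscrs] at hD ⊢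
  exact ⟨⟨hD.1.1, hD.1.2.trans_le (by exact_mod_cast h)⟩, hD.2⟩

/-! ### The transport: the block `𝒟ₙ₊₁` under `d ↦ D⁺(d)` is the disjoint union of two windows -/

/-- **Transport lemma.** For `n ≥ 2` and any `f`, summing `f (D⁺ d)` over `d ∈ 𝒟ₙ₊₁` is summing
`f` over the ramified window `{3·2ⁿ ≤ D < 3·2ⁿ⁺¹, 3 ∣ D}` plus the unramified window
`{2ⁿ ≤ 3D < 2ⁿ⁺¹, 3 ∤ D}` of positive fundamental discriminants (the bijections `d ↦ 3d`,
`d ↦ d/3`; `3D < 2ᵐ ⟺ D < (2ᵐ + 2)/3`). [folklore] -/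
theorem sum_fundBlock_mirror_eq {n : ℕ} (hn : 2 ≤ n) (f : ℤ → ℝ) :
    ∑ d ∈ Negative.fundBlock (n + 1), f (if 3 ∣ d then ((d / 3 : ℕ) : ℤ) else 3 * (d : ℤ)) =
      ∑ D ∈ {D ∈ posFundDiscrs (3 * 2 ^ (n + 1)) | (3 : ℤ) ∣ D} \
          {D ∈ posFundDiscrs (3 * 2 ^ n) | (3 : ℤ) ∣ D}, f D +
        ∑ D ∈ {D ∈ posFundDiscrs ((2 ^ (n + 1) + 2) / 3) | ¬ (3 : ℤ) ∣ D} \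
          {D ∈ posFundDiscrs ((2 ^ n + 2) / 3) | ¬ (3 : ℤ) ∣ D}, f D := by
  have h2n : 0 < 2 ^ n := Nat.two_pow_pos n
  have h4 : 4 ≤ 2 ^ n := by simpa using Nat.pow_le_pow_right Nat.two_pos hn
  rw [← Finset.sum_filter_add_sum_filter_not (Negative.fundBlock (n + 1)) (fun d : ℕ => 3 ∣ d),
    add_comm]
  congr 1
  · -- ramified leg: `3 ∤ d`, `d ↦ 3d`
    refine Finset.sum_nbij' (fun d : ℕ => 3 * (d : ℤ)) (fun D : ℤ => D.toNat / 3) ?_ ?_ ?_ ?_ ?_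
    · intro d hd
      simp only [Finset.mem_filter, Negative.fundBlock, Finset.mem_Ico, add_tsub_cancel_right] at hd
      obtain ⟨⟨⟨hlo, hhi⟩, hf⟩, h3⟩ := hd
      have hP := posFund_three_mul_iff.2 ⟨hf, h3⟩
      simp only [Finset.mem_sdiff, Finset.mem_filter, mem_posFundDiscrs]
      refine ⟨⟨⟨⟨by omega, by omega⟩, hP⟩, dvd_mul_right 3 _⟩, ?_⟩
      rintro ⟨⟨⟨-, hlt⟩, -⟩, -⟩
      omega
    · intro D hD
      simp only [Finset.mem_sdiff, Finset.mem_filter, mem_posFundDiscrs] at hD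
      obtain ⟨⟨⟨⟨h0, hlt⟩, hP⟩, h3⟩, hnot⟩ := hD
      obtain ⟨d, rfl⟩ : ∃ d : ℕ, D = 3 * (d : ℤ) := ⟨D.toNat / 3, by omega⟩
      have hj : (3 * (d : ℤ)).toNat / 3 = d := by omega
      obtain ⟨hf, h3d⟩ := posFund_three_mul_iff.1 hP
      have hlo : 2 ^ n ≤ d := by
        by_contra hlt'
        exact hnot ⟨⟨⟨h0, by omega⟩, hP⟩, h3⟩
      simp only [hj, Finset.mem_filter, Negative.fundBlock, Finset.mem_Ico, add_tsub_cancel_right]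
      exact ⟨⟨⟨hlo, by omega⟩, hf⟩, h3d⟩
    · intro d _
      omega
    · intro D hD
      simp only [Finset.mem_sdiff, Finset.mem_filter, mem_posFundDiscrs] at hD
      obtain ⟨⟨⟨⟨h0, -⟩, -⟩, h3⟩, -⟩ := hD
      omega
    · intro d hd
      rw [if_neg (Finset.mem_filter.1 hd).2]
  · -- unramified leg: `3 ∣ d`, `d ↦ d / 3`
    refine Finset.sum_nbij' (fun d : ℕ => ((d / 3 : ℕ) : ℤ)) (fun D : ℤ => 3 * D.toNat) ?_ ?_ ?_ ?_ ?_
    · intro d hd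
      simp only [Finset.mem_filter, Negative.fundBlock, Finset.mem_Ico, add_tsub_cancel_right] at hd
      obtain ⟨⟨⟨hlo, hhi⟩, hf⟩, ⟨D, rfl⟩⟩ := hd
      have hD1 : D ≠ 1 := by omega
      obtain ⟨hP, h3D⟩ := (negFund_three_mul_iff hD1).1 hf
      have hi : 3 * D / 3 = D := by omega
      simp only [hi, Finset.mem_sdiff, Finset.mem_filter, mem_posFundDiscrs]
      refine ⟨⟨⟨⟨by omega, by omega⟩, hP⟩, by omega⟩, ?_⟩
      rintro ⟨⟨⟨-, hlt⟩, -⟩, -⟩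
      omega
    · intro D hD
      simp only [Finset.mem_sdiff, Finset.mem_filter, mem_posFundDiscrs] at hD
      obtain ⟨⟨⟨⟨h0, hlt⟩, hP⟩, h3⟩, hnot⟩ := hD
      obtain ⟨E, rfl⟩ : ∃ E : ℕ, D = (E : ℤ) := ⟨D.toNat, by omega⟩
      have hge : (2 ^ n + 2) / 3 ≤ E := by
        by_contra hlt'
        exact hnot ⟨⟨⟨h0, by omega⟩, hP⟩, h3⟩
      have hE1 : E ≠ 1 := by omega
      have h3' : ¬ 3 ∣ E := by omega
      have hf := (negFund_three_mul_iff hE1).2 ⟨hP, h3'⟩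
      simp only [Int.toNat_natCast, Finset.mem_filter, Negative.fundBlock, Finset.mem_Ico,
        add_tsub_cancel_right]
      exact ⟨⟨⟨by omega, by omega⟩, hf⟩, dvd_mul_right 3 E⟩
    · intro d hd
      have h3 := (Finset.mem_filter.1 hd).2
      omega
    · intro D hD
      simp only [Finset.mem_sdiff, Finset.mem_filter, mem_posFundDiscrs] at hD
      obtain ⟨⟨⟨⟨h0, -⟩, -⟩, -⟩, -⟩ := hD
      omega
    · intro d hd
      rw [if_pos (Finset.mem_filter.1 hd).2]

/-- The ramified windows are nested. [folklore] -/
theorem rf_window_subset (n : ℕ) :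
    {D ∈ posFundDiscrs (3 * 2 ^ n) | (3 : ℤ) ∣ D} ⊆ {D ∈ posFundDiscrs (3 * 2 ^ (n + 1)) | (3 : ℤ) ∣ D} :=
  Finset.filter_subset_filter _ (posFundDiscrs_mono
    (Nat.mul_le_mul_left 3 (Nat.pow_le_pow_right Nat.two_pos (Nat.le_succ n))))

/-- The unramified windows are nested. [folklore] -/
theorem uf_window_subset (n : ℕ) :
    {D ∈ posFundDiscrs ((2 ^ n + 2) / 3) | ¬ (3 : ℤ) ∣ D} ⊆
      {D ∈ posFundDiscrs ((2 ^ (n + 1) + 2) / 3) | ¬ (3 : ℤ) ∣ D} :=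
  Finset.filter_subset_filter _ (posFundDiscrs_mono (Nat.div_le_div_right
    (Nat.add_le_add_right (Nat.pow_le_pow_right Nat.two_pos (Nat.le_succ n)) 2)))

/-- A power of `3` other than `1` is `≥ 3`: `𝟙[#Cl₃(D) ≠ 1] ≤ (#Cl₃(D) − 1)/2`. [folklore] -/
theorem one_le_half_sub_one {D : ℤ} (h : quadFieldThreeTorsion D ≠ 1) :
    (1 : ℝ) ≤ ((quadFieldThreeTorsion D : ℝ) - 1) / 2 := by
  obtain ⟨r, hr⟩ := exists_quadFieldThreeTorsion_eq_pow D
  have h3 : 3 ≤ quadFieldThreeTorsion D := by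
    rw [hr] at h ⊢
    rcases r with _ | r
    · simp at h
    · calc (3 : ℕ) = 3 ^ 1 := by norm_num
        _ ≤ 3 ^ (r + 1) := Nat.pow_le_pow_right (by norm_num) (by omega)
  have h3' : (3 : ℝ) ≤ quadFieldThreeTorsion D := by exact_mod_cast h3
  linarith

/-- `(#Cl₃(D) − 1)/2 ≥ 0` (`quadFieldThreeTorsion_pos`). [folklore] -/
theorem half_sub_one_nonneg (D : ℤ) : (0 : ℝ) ≤ ((quadFieldThreeTorsion D : ℝ) - 1) / 2 := by
  have h1 : (1 : ℝ) ≤ quadFieldThreeTorsion D := by exact_mod_cast quadFieldThreeTorsion_pos D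
  linarith

/-- `Σ (#Cl₃ − 1)/2 = (Σ #Cl₃ − #s)/2` over any finset. [folklore] -/
theorem sum_half_sub_one (s : Finset ℤ) :
    ∑ D ∈ s, ((quadFieldThreeTorsion D : ℝ) - 1) / 2 =
      (∑ D ∈ s, (quadFieldThreeTorsion D : ℝ) - s.card) / 2 := by
  rw [← Finset.sum_div, Finset.sum_sub_distrib, Finset.sum_const, nsmul_eq_mul, mul_one]

/-! ### The two counts of level `n + 1` in terms of the facts' running sums -/

/-- `#𝒟ₙ₊₁` is the sum of the two window counts (`n ≥ 2`). [folklore] -/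
theorem card_fundBlock_succ_eq {n : ℕ} (hn : 2 ≤ n) :
    ((Negative.fundBlock (n + 1)).card : ℝ) =
      (({D ∈ posFundDiscrs (3 * 2 ^ (n + 1)) | (3 : ℤ) ∣ D}.card : ℝ) -
          {D ∈ posFundDiscrs (3 * 2 ^ n) | (3 : ℤ) ∣ D}.card) +
        (({D ∈ posFundDiscrs ((2 ^ (n + 1) + 2) / 3) | ¬ (3 : ℤ) ∣ D}.card : ℝ) -
          {D ∈ posFundDiscrs ((2 ^ n + 2) / 3) | ¬ (3 : ℤ) ∣ D}.card) := by
  have h := sum_fundBlock_mirror_eq hn (fun _ => (1 : ℝ))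
  simp only [Finset.sum_const, nsmul_eq_mul, mul_one] at h
  rw [h, Finset.cast_card_sdiff (rf_window_subset n), Finset.cast_card_sdiff (uf_window_subset n)]

/-- **Markov + transport**: the number of `d ∈ 𝒟ₙ₊₁` with `#Cl₃(D⁺(d)) ≠ 1` is at most half the
window excess `Σ_window (#Cl₃ − 1)`, written with the facts' running sums (`n ≥ 2`). [folklore] -/
theorem card_bad_succ_le {n : ℕ} (hn : 2 ≤ n) :
    (((Negative.fundBlock (n + 1)).filter fun d : ℕ =>
        quadFieldThreeTorsion (if 3 ∣ d then ((d / 3 : ℕ) : ℤ) else 3 * (d : ℤ)) ≠ 1).card : ℝ) ≤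
      1 / 2 * (((∑ D ∈ posFundDiscrs (3 * 2 ^ (n + 1)) with (3 : ℤ) ∣ D, (quadFieldThreeTorsion D : ℝ)) -
              {D ∈ posFundDiscrs (3 * 2 ^ (n + 1)) | (3 : ℤ) ∣ D}.card -
            ((∑ D ∈ posFundDiscrs (3 * 2 ^ n) with (3 : ℤ) ∣ D, (quadFieldThreeTorsion D : ℝ)) -
              {D ∈ posFundDiscrs (3 * 2 ^ n) | (3 : ℤ) ∣ D}.card)) +
          ((∑ D ∈ posFundDiscrs ((2 ^ (n + 1) + 2) / 3) with ¬ (3 : ℤ) ∣ D, (quadFieldThreeTorsion D : ℝ)) -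
              {D ∈ posFundDiscrs ((2 ^ (n + 1) + 2) / 3) | ¬ (3 : ℤ) ∣ D}.card -
            ((∑ D ∈ posFundDiscrs ((2 ^ n + 2) / 3) with ¬ (3 : ℤ) ∣ D, (quadFieldThreeTorsion D : ℝ)) -
              {D ∈ posFundDiscrs ((2 ^ n + 2) / 3) | ¬ (3 : ℤ) ∣ D}.card))) := by
  have h := sum_fundBlock_mirror_eq hn (fun D => ((quadFieldThreeTorsion D : ℝ) - 1) / 2)
  rw [Finset.sum_sdiff_eq_sub (rf_window_subset n), Finset.sum_sdiff_eq_sub (uf_window_subset n),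
    sum_half_sub_one, sum_half_sub_one, sum_half_sub_one, sum_half_sub_one] at h
  calc _ ≤ ∑ d ∈ Negative.fundBlock (n + 1),
        ((quadFieldThreeTorsion (if 3 ∣ d then ((d / 3 : ℕ) : ℤ) else 3 * (d : ℤ)) : ℝ) - 1) / 2 := by
        rw [Finset.cast_card]
        refine (Finset.sum_le_sum fun d hd => one_le_half_sub_one (Finset.mem_filter.1 hd).2).trans ?_
        exact Finset.sum_le_sum_of_subset_of_nonneg (Finset.filter_subset _ _)
          fun d _ _ => half_sub_one_nonneg _
    _ = _ := h
    _ = _ := by ring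

/-- From mean `4/3` and density `c > 0`: the excess `Σ (#Cl₃ − 1)` has density `c/3`. [folklore] -/
theorem tendsto_excess_div {N S : ℕ → ℝ} {c : ℝ} (hc : 0 < c)
    (hM : Tendsto (fun X => S X / N X) atTop (𝓝 (4 / 3)))
    (hN : Tendsto (fun X : ℕ => N X / (X : ℝ)) atTop (𝓝 c)) :
    Tendsto (fun X : ℕ => (S X - N X) / (X : ℝ)) atTop (𝓝 (c / 3)) := by
  have hne : ∀ᶠ X : ℕ in atTop, N X ≠ 0 := by
    filter_upwards [hN.eventually_const_lt hc] with X hX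
    intro h0
    rw [h0, zero_div] at hX
    exact lt_irrefl 0 hX
  have hS : Tendsto (fun X : ℕ => S X / (X : ℝ)) atTop (𝓝 (4 / 3 * c)) := by
    refine (hM.mul hN).congr' ?_
    filter_upwards [hne] with X hX
    rw [div_mul_div_comm, mul_comm (N X) _, mul_div_mul_right _ _ hX]
  have key : (fun X : ℕ => (S X - N X) / (X : ℝ)) = fun X => S X / X - N X / X :=
    funext fun X => sub_div _ _ _
  rw [key, show c / 3 = 4 / 3 * c - c by ring]
  exact hS.sub hN

/-- Rescaling a density statement `G(X)/X → L` along `a(n)` with `a(n)/2ⁿ → r > 0`: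
`G(a(n))/2ⁿ → L·r`. [folklore] -/
theorem tendsto_rescale {G : ℕ → ℝ} {L r : ℝ} {a : ℕ → ℕ} (hr : 0 < r)
    (hG : Tendsto (fun X : ℕ => G X / (X : ℝ)) atTop (𝓝 L))
    (ha : Tendsto (fun n : ℕ => (a n : ℝ) / 2 ^ n) atTop (𝓝 r)) :
    Tendsto (fun n : ℕ => G (a n) / 2 ^ n) atTop (𝓝 (L * r)) := by
  have h2 : ∀ n : ℕ, (2 : ℝ) ^ n ≠ 0 := fun n => pow_ne_zero n two_ne_zero
  have haT : Tendsto (fun n : ℕ => (a n : ℝ)) atTop atTop := by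
    have h := ha.pos_mul_atTop hr (tendsto_pow_atTop_atTop_of_one_lt one_lt_two)
    exact h.congr' (Eventually.of_forall fun n => div_mul_cancel₀ _ (h2 n))
  have haN : Tendsto a atTop atTop := tendsto_natCast_atTop_iff.1 haT
  have h1 : Tendsto (fun n => G (a n) / (a n : ℝ)) atTop (𝓝 L) := hG.comp haN
  refine (h1.mul ha).congr' ?_
  filter_upwards [haT.eventually_ne_atTop 0] with n hn
  rw [div_mul_div_comm, mul_comm (a n : ℝ) _, mul_div_mul_right _ _ hn]

/-- `⌊(2ⁿ⁺ᵏ + 2)/3⌋ / 2ⁿ → 2ᵏ/3` (squeeze: `2ᵐ ≤ 3⌊(2ᵐ + 2)/3⌋ ≤ 2ᵐ + 2`). [folklore] -/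
theorem tendsto_thirds_div (k : ℕ) :
    Tendsto (fun n : ℕ => (((2 ^ (n + k) + 2) / 3 : ℕ) : ℝ) / 2 ^ n) atTop (𝓝 ((2 : ℝ) ^ k / 3)) := by
  have h2 : ∀ n : ℕ, (0 : ℝ) < 2 ^ n := fun n => pow_pos two_pos n
  have hup : Tendsto (fun n : ℕ => (2 : ℝ) ^ k / 3 + ((2 : ℝ) ^ n)⁻¹) atTop (𝓝 ((2 : ℝ) ^ k / 3)) := by
    have h := tendsto_inv_atTop_zero.comp (tendsto_pow_atTop_atTop_of_one_lt (one_lt_two (α := ℝ)))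
    simpa using (tendsto_const_nhds (x := (2 : ℝ) ^ k / 3)).add h
  refine tendsto_of_tendsto_of_tendsto_of_le_of_le tendsto_const_nhds hup (fun n => ?_) (fun n => ?_)
  · have hlo : 2 ^ (n + k) ≤ 3 * ((2 ^ (n + k) + 2) / 3) := by omega
    have hlo' : (2 : ℝ) ^ n * 2 ^ k ≤ 3 * (((2 ^ (n + k) + 2) / 3 : ℕ) : ℝ) := by
      rw [← pow_add]; exact_mod_cast hlo
    rw [le_div_iff₀ (h2 n)]
    linarith
  · have hhi : 3 * ((2 ^ (n + k) + 2) / 3) ≤ 2 ^ (n + k) + 2 := by omega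
    have hhi' : 3 * (((2 ^ (n + k) + 2) / 3 : ℕ) : ℝ) ≤ (2 : ℝ) ^ n * 2 ^ k + 2 := by
      rw [← pow_add]; exact_mod_cast hhi
    rw [div_le_iff₀ (h2 n), add_mul, inv_mul_cancel₀ (h2 n).ne']
    linarith

/-- Real-inequality endgame: clearing the common factor `2ⁿ > 0`. [folklore] -/
theorem endgame {a b c d e f g h P bad blk ε : ℝ} (hP : 0 < P)
    (hlt : 1 / 2 * ((a / P - b / P) + (c / P - d / P)) -
      (1 / 6 + ε) * ((e / P - f / P) + (g / P - h / P)) < 0)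
    (hbad : bad ≤ 1 / 2 * ((a - b) + (c - d))) (hblk : blk = (e - f) + (g - h)) :
    bad ≤ (1 / 6 + ε) * blk := by
  have key : (1 / 2 * ((a / P - b / P) + (c / P - d / P)) -
      (1 / 6 + ε) * ((e / P - f / P) + (g / P - h / P))) * P =
        1 / 2 * ((a - b) + (c - d)) - (1 / 6 + ε) * ((e - f) + (g - h)) := by
    field_simp
  have hneg := mul_neg_of_neg_of_pos hlt hP
  rw [key] at hneg
  rw [hblk]
  linarith

/-- **Stub `stub_mirrorRankRare` of line `mirror-unit-signature`: 3-torsion is rare in the mirror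
family.** Given the Bhargava–Varma named facts `bv_threeTorsion_mean_localAtThree` (mean `4/3` of
`#Cl₃(D)` over the positive fundamental `D < X` with `3 ∣ D`, resp. `3 ∤ D`) and
`bv_count_posFundDiscrs_localAtThree` (both families have positive density `c_r, c_u`), for every
`ε > 0`, eventually in `n`, at most `(1/6 + ε)·#𝒟ₙ` of the `d ∈ 𝒟ₙ = Negative.fundBlock n` have
`#Cl₃(D⁺(d)) ≠ 1` (`D⁺(d) = d/3` if `3 ∣ d`, `3d` if `3 ∤ d`): transport, Markov, and the limits
`#𝒟ₙ₊₁/2ⁿ → 3c_r + c_u/3`, `½ Σ_windows (#Cl₃ − 1)/2ⁿ → c_r/2 + c_u/18 = (3c_r + c_u/3)/6`. [folklore] -/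
theorem stub_mirrorRankRare :
    bv_threeTorsion_mean_localAtThree → bv_count_posFundDiscrs_localAtThree →
    ∀ ε : ℝ, 0 < ε → ∀ᶠ n : ℕ in atTop,
      ((((Negative.fundBlock n).filter fun d : ℕ =>
          quadFieldThreeTorsion (if 3 ∣ d then ((d / 3 : ℕ) : ℤ) else 3 * (d : ℤ)) ≠ 1).card : ℝ))
        ≤ (1 / 6 + ε) * ((Negative.fundBlock n).card : ℝ) := by
  intro hM hC ε hε
  obtain ⟨cr, hcr, hNr⟩ := hC.1
  obtain ⟨cu, hcu, hNu⟩ := hC.2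
  have hEr := tendsto_excess_div hcr hM.1 hNr
  have hEu := tendsto_excess_div hcu hM.2 hNu
  have h2 : ∀ n : ℕ, (2 : ℝ) ^ n ≠ 0 := fun n => pow_ne_zero n two_ne_zero
  have h6 : Tendsto (fun n : ℕ => ((3 * 2 ^ (n + 1) : ℕ) : ℝ) / 2 ^ n) atTop (𝓝 6) :=
    tendsto_const_nhds.congr fun n => by rw [eq_div_iff (h2 n)]; push_cast; ring
  have h3 : Tendsto (fun n : ℕ => ((3 * 2 ^ n : ℕ) : ℝ) / 2 ^ n) atTop (𝓝 3) :=
    tendsto_const_nhds.congr fun n => by rw [eq_div_iff (h2 n)]; push_cast; ring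
  have h23 : Tendsto (fun n : ℕ => (((2 ^ (n + 1) + 2) / 3 : ℕ) : ℝ) / 2 ^ n) atTop (𝓝 (2 / 3)) := by
    convert tendsto_thirds_div 1 using 2
    norm_num
  have h13 : Tendsto (fun n : ℕ => (((2 ^ n + 2) / 3 : ℕ) : ℝ) / 2 ^ n) atTop (𝓝 (1 / 3)) := by
    convert tendsto_thirds_div 0 using 2 <;> norm_num
  have A1 := tendsto_rescale (by norm_num) hNr h6
  have A2 := tendsto_rescale (by norm_num) hNr h3
  have A3 := tendsto_rescale (by norm_num) hNu h23
  have A4 := tendsto_rescale (by norm_num) hNu h13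
  have B1 := tendsto_rescale (by norm_num) hEr h6
  have B2 := tendsto_rescale (by norm_num) hEr h3
  have B3 := tendsto_rescale (by norm_num) hEu h23
  have B4 := tendsto_rescale (by norm_num) hEu h13
  have hlim := (((B1.sub B2).add (B3.sub B4)).const_mul (1 / 2 : ℝ)).sub
    (((A1.sub A2).add (A3.sub A4)).const_mul (1 / 6 + ε))
  have hev := hlim.eventually_lt_const (u := 0) (by nlinarith [mul_pos hε hcr, mul_pos hε hcu])
  have key : ∀ᶠ n : ℕ in atTop,
      ((((Negative.fundBlock (n + 1)).filter fun d : ℕ =>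
          quadFieldThreeTorsion (if 3 ∣ d then ((d / 3 : ℕ) : ℤ) else 3 * (d : ℤ)) ≠ 1).card : ℝ))
        ≤ (1 / 6 + ε) * ((Negative.fundBlock (n + 1)).card : ℝ) := by
    filter_upwards [hev, eventually_ge_atTop 2] with n hn h2n
    exact endgame (pow_pos two_pos n) hn (card_bad_succ_le h2n) (card_fundBlock_succ_eq h2n)
  obtain ⟨N, hN⟩ := eventually_atTop.1 key
  refine eventually_atTop.2 ⟨N + 1, fun n hn => ?_⟩
  obtain ⟨m, rfl⟩ : ∃ m, n = m + 1 := ⟨n - 1, by omega⟩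
  exact hN m (by omega)

end Summit.QuantumAdvantage.QuantumAdvantage.Theorems.AvgFaceBeyondPrior.Mirror
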